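import Mathlib.Analysis.Convolution
import Mathlib.Analysis.SpecialFunctions.Gamma.Beta
import Mathlib.Analysis.SpecialFunctions.Integrability.Basic
import HarnessLib

/-!
# Riemann–Liouville integrals on a finite interval: semigroup law and injectivity on functions
# with an algebraic branch point

Topic `Literature/Analysis/ODE` (namespace `Literature.Analysis.ODE`, sub-namespace
`RiemannLiouville`).

For a base point `a` and an order `μ ∈ ℂ`, `Re μ > 0`, the (Gamma-free) Riemann–Liouville integral
of a function `v` on `(a, b)` is
`(J^μ_{a+} v)(z) = ∫_a^z (z−w)^{μ−1} v(w) dw`   (`rlIntegral a μ v z`; the classical `I^μ_{a+}` is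
`Γ(μ)⁻¹ J^μ`). PROVED here, for `v` continuous on `(a,b)` and integrable near `a`:

* the SEMIGROUP LAW `J^ν (J^μ v) = B(μ,ν) · J^{μ+ν} v` on `(a,b)` (`B` = Euler's Beta integral,
  `Complex.betaIntegral`), [SamkoKilbasMarichev1993, §2.3 (2.21)], obtained from the associativity
  of convolution on `ℝ` (`MeasureTheory.convolution_assoc`) and `Complex.betaIntegral_scaled`;
* integer orders: `J^1 v` is a primitive of `v`, `(J^{n+2} v)' = (n+1) J^{n+1} v`;
* `J^ν` of the powers `(w−a)^j`;
* INJECTIVITY OFF RESONANCE: if `v = (w−a)^ρ h(w)` near `a⁺` with `h` smooth on a two-sided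
  neighbourhood of `a`, `Re ρ > −1`, and `J^μ v` coincides on `(a,b)` with a polynomial of degree
  `< k` in `(z−a)`, then `v ≡ 0` on `(a,b)` PROVIDED `ρ + μ − k ∉ ℤ_{≤ −1}` (non-resonance). The
  mechanism: `J^{N−μ} ∘ J^μ = B · J^N` turns the hypothesis into an explicit formula
  `v = Σ_{j<k} c_j (w−a)^{j−μ}`, and finitely many powers `(w−a)^{d+j}` with NO exponent in `ℕ`
  are linearly independent of the smooth functions at `a` (`cpow_sum_indep_of_smooth`). At
  resonance the statement is false (`J^μ` composed with `k` derivatives is the Riemann–Liouville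
  DERIVATIVE `D^{k−μ}`, which kills `(w−a)^{k−μ−i}`, `1 ≤ i ≤ k`).

This is the injectivity half of the one-sided Euler / Riemann–Liouville transform of Heun's
equation (K. Takemura, [Takemura2017] Prop. 1.2, real one-sided path), in the exact shape consumed
by the Kerr–de Sitter venture's `RouteW.EulerRLNonRes`; the transform itself lives in
`HeunEulerTransform.lean` / `HeunEulerIntegrals.lean`. No named facts are introduced.

## References
* S. G. Samko, A. A. Kilbas, O. I. Marichev, *Fractional integrals and derivatives*, Gordon and
  Breach 1993, §2.3 (semigroup property (2.21)), §2.5 (compositions with derivatives). [folklore]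
* K. Takemura, J. Math. Soc. Japan 69 (2017) 849–891, Prop. 1.2. Key `Takemura2017`.
-/

noncomputable section

open Set Filter MeasureTheory intervalIntegral Complex
open scoped Topology Interval Convolution

namespace Literature.Analysis.ODE

namespace RiemannLiouville

/-! ### Definitions -/

/-- The Gamma-free Riemann–Liouville integral of order `μ` with base point `a`:
`(J^μ_{a+} v)(z) = ∫_a^z (z−w)^{μ−1} v(w) dw`. [cite: SamkoKilbasMarichev1993, §2.3 (2.17)] -/
def rlIntegral (a : ℝ) (μ : ℂ) (v : ℝ → ℂ) (z : ℝ) : ℂ :=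
  ∫ w in a..z, ((z - w : ℝ) : ℂ) ^ (μ - 1) * v w

/-- The Riemann–Liouville convolution kernel on `ℝ`: `x^{μ−1}` for `x > 0`, `0` for `x ≤ 0`.
[cite: SamkoKilbasMarichev1993, §2.3] -/
def rlKernel (μ : ℂ) : ℝ → ℂ :=
  indicator (Ioi 0) fun x : ℝ => (x : ℂ) ^ (μ - 1)

/-- The class of functions on `(a,b)` on which `J^μ_{a+}` is studied here: continuous on the open
interval and integrable near the base point (a subclass of `L₁(a,c)`, `c < b`, on which
`I^μ_{a+}` is defined). [cite: SamkoKilbasMarichev1993, §2.3 (Definition 2.1)] -/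
def RLAdmissible (a b : ℝ) (v : ℝ → ℂ) : Prop :=
  ContinuousOn v (Ioo a b) ∧ ∀ c ∈ Ioo a b, IntegrableOn v (Ioo a c)

/-! ### The kernel -/

/-- Value of the kernel at a positive point. [cite: SamkoKilbasMarichev1993, §2.3 (2.17)] -/
theorem rlKernel_of_pos (μ : ℂ) {x : ℝ} (hx : 0 < x) : rlKernel μ x = (x : ℂ) ^ (μ - 1) :=
  indicator_of_mem (mem_Ioi.mpr hx) _

/-- The kernel vanishes at non-positive points. [cite: SamkoKilbasMarichev1993, §2.3 (2.17)] -/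
theorem rlKernel_of_nonpos (μ : ℂ) {x : ℝ} (hx : x ≤ 0) : rlKernel μ x = 0 :=
  indicator_of_notMem (notMem_Ioi.mpr hx) _

/-- `t ↦ (t : ℂ)^s` is continuous on `(0, ∞)`. [folklore] -/
private theorem continuousOn_ofReal_cpow_Ioi (s : ℂ) :
    ContinuousOn (fun t : ℝ => (t : ℂ) ^ s) (Ioi 0) := fun _ ht =>
  (continuousAt_ofReal_cpow_const _ _ (Or.inr (ne_of_gt ht))).continuousWithinAt

/-- The kernel is a.e.-strongly measurable. [cite: SamkoKilbasMarichev1993, §2.3 (2.17)] -/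
theorem aestronglyMeasurable_rlKernel (μ : ℂ) : AEStronglyMeasurable (rlKernel μ) volume := by
  unfold rlKernel
  rw [aestronglyMeasurable_indicator_iff measurableSet_Ioi]
  exact (continuousOn_ofReal_cpow_Ioi _).aestronglyMeasurable measurableSet_Ioi

/-- Norm of the kernel at a positive point: `‖x^{μ−1}‖ = x^{Re μ − 1}`.
[cite: SamkoKilbasMarichev1993, §2.3 (2.17)] -/
theorem norm_rlKernel_of_pos (μ : ℂ) {x : ℝ} (hx : 0 < x) :
    ‖rlKernel μ x‖ = x ^ (μ.re - 1) := by
  rw [rlKernel_of_pos μ hx, norm_cpow_eq_rpow_re_of_pos hx]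
  simp

/-! ### From convolutions on `ℝ` to interval integrals -/

/-- The convolution of `1_{(a,c)} v` with the kernel, at a point `x ≤ a`, vanishes. [folklore] -/
private theorem convolution_indicator_rlKernel_of_le {a c x : ℝ} (v : ℝ → ℂ) (μ : ℂ) (hx : x ≤ a) :
    (indicator (Ioo a c) v ⋆[ContinuousLinearMap.mul ℂ ℂ, volume] rlKernel μ) x = 0 := by
  rw [convolution_def]
  refine integral_eq_zero_of_ae (Eventually.of_forall fun t => ?_)
  simp only [ContinuousLinearMap.mul_apply', Pi.zero_apply]
  by_cases ht : t ∈ Ioo a c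
  · rw [rlKernel_of_nonpos μ (by linarith [ht.1] : x - t ≤ 0), mul_zero]
  · rw [indicator_of_notMem ht, zero_mul]

/-- The convolution of `1_{(a,c)} v` with the kernel, at a point `x ∈ (a, c]`, is the
Riemann–Liouville integral `J^μ_{a+} v (x)`. [cite: SamkoKilbasMarichev1993, §2.3] -/
theorem convolution_indicator_rlKernel {a c x : ℝ} (v : ℝ → ℂ) (μ : ℂ) (hax : a < x)
    (hxc : x ≤ c) :
    (indicator (Ioo a c) v ⋆[ContinuousLinearMap.mul ℂ ℂ, volume] rlKernel μ) x =
      rlIntegral a μ v x := by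
  rw [convolution_def, rlIntegral, intervalIntegral.integral_of_le hax.le,
    integral_Ioc_eq_integral_Ioo, ← MeasureTheory.integral_indicator measurableSet_Ioo]
  congr 1 with t
  simp only [ContinuousLinearMap.mul_apply']
  by_cases ht : t ∈ Ioo a x
  · have htc : t ∈ Ioo a c := ⟨ht.1, lt_of_lt_of_le ht.2 hxc⟩
    rw [indicator_of_mem ht, indicator_of_mem htc, rlKernel_of_pos μ (sub_pos.mpr ht.2), mul_comm]
  · rw [indicator_of_notMem ht]
    rcases le_or_gt t a with hta | hta
    · rw [indicator_of_notMem (fun h : t ∈ Ioo a c => not_le.mpr h.1 hta), zero_mul]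
    · have htx : x ≤ t := by
        by_contra h
        exact ht ⟨hta, not_le.mp h⟩
      rw [rlKernel_of_nonpos μ (sub_nonpos.mpr htx), mul_zero]

/-! ### The kernels convolve to a kernel: `x^{μ−1} ⋆ x^{ν−1} = B(μ,ν) x^{μ+ν−1}` -/

/-- `K_μ ⋆ K_ν = B(μ,ν) · K_{μ+ν}` pointwise on `ℝ` (Euler's Beta integral, scaled).
[cite: SamkoKilbasMarichev1993, §2.3 (2.21)] -/
theorem convolution_rlKernel (μ ν : ℂ) (y : ℝ) :
    (rlKernel μ ⋆[ContinuousLinearMap.mul ℂ ℂ, volume] rlKernel ν) y =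
      betaIntegral μ ν * rlKernel (μ + ν) y := by
  rw [convolution_def]
  simp only [ContinuousLinearMap.mul_apply']
  rcases le_or_gt y 0 with hy | hy
  · rw [rlKernel_of_nonpos _ hy, mul_zero]
    refine integral_eq_zero_of_ae (Eventually.of_forall fun t => ?_)
    simp only [Pi.zero_apply]
    rcases le_or_gt t 0 with ht | ht
    · rw [rlKernel_of_nonpos μ ht, zero_mul]
    · rw [rlKernel_of_nonpos ν (by linarith : y - t ≤ 0), mul_zero]
  · rw [rlKernel_of_pos _ hy, mul_comm (betaIntegral μ ν),
      ← betaIntegral_scaled μ ν hy, intervalIntegral.integral_of_le hy.le,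
      integral_Ioc_eq_integral_Ioo, ← MeasureTheory.integral_indicator measurableSet_Ioo]
    congr 1 with t
    by_cases ht : t ∈ Ioo 0 y
    · rw [indicator_of_mem ht, rlKernel_of_pos μ ht.1, rlKernel_of_pos ν (sub_pos.mpr ht.2)]
      push_cast
      ring
    · rw [indicator_of_notMem ht]
      rcases le_or_gt t 0 with ht0 | ht0
      · rw [rlKernel_of_nonpos μ ht0, zero_mul]
      · have hty : y ≤ t := by
          by_contra h
          exact ht ⟨ht0, not_le.mp h⟩
        rw [rlKernel_of_nonpos ν (sub_nonpos.mpr hty), mul_zero]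

/-! ### Integrability -/

/-- The kernel `t ↦ (y−t)^{μ−1}` is interval integrable up to `y` (`Re μ > 0`). [folklore] -/
private theorem intervalIntegrable_kernel {μ : ℂ} (hμ : 0 < μ.re) (l y : ℝ) :
    IntervalIntegrable (fun t : ℝ => ((y - t : ℝ) : ℂ) ^ (μ - 1)) volume l y := by
  have h : -1 < (μ - 1).re := by simp; linarith
  have := (intervalIntegral.intervalIntegrable_cpow' (a := y - l) (b := 0) h).comp_sub_left y
  simpa using this

/-- The kernel `t ↦ (y−t)^{μ−1}` is continuous on `(−∞, y)`. [folklore] -/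
private theorem continuousOn_kernel (μ : ℂ) (y : ℝ) :
    ContinuousOn (fun t : ℝ => ((y - t : ℝ) : ℂ) ^ (μ - 1)) (Iio y) := by
  intro t ht
  have h1 : ContinuousAt (fun s : ℝ => (s : ℂ) ^ (μ - 1)) (y - t) :=
    continuousAt_ofReal_cpow_const _ _ (Or.inr (sub_pos.mpr (mem_Iio.mp ht)).ne')
  have h2 : ContinuousAt (fun s : ℝ => y - s) t := by fun_prop
  exact (ContinuousAt.comp (g := fun s : ℝ => (s : ℂ) ^ (μ - 1)) h1 h2).continuousWithinAt

/-- An admissible `v` times the kernel `(y−t)^{μ−1}` is integrable on `(a, m)` whenever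
`a < m < b` and `m ≤ y` (`Re μ > 0`). [cite: SamkoKilbasMarichev1993, §2.3 (Lemma 2.1)] -/
theorem integrableOn_mul_kernel {a b : ℝ} {v : ℝ → ℂ} (hv : RLAdmissible a b v) {μ : ℂ}
    (hμ : 0 < μ.re) {m y : ℝ} (ham : a < m) (hmb : m < b) (hmy : m ≤ y) :
    IntegrableOn (fun t => v t * ((y - t : ℝ) : ℂ) ^ (μ - 1)) (Ioo a m) := by
  set m' := (a + m) / 2 with hm'
  have ham' : a < m' := by rw [hm']; linarith
  have hm'm : m' < m := by rw [hm']; linarith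
  -- near the base point: `v` integrable, kernel continuous on a compact set
  have h1 : IntegrableOn (fun t => v t * ((y - t : ℝ) : ℂ) ^ (μ - 1)) (Ioo a m') := by
    refine IntegrableOn.mul_continuousOn_of_subset (hv.2 m' ⟨ham', hm'm.trans hmb⟩) ?_
      measurableSet_Ioo isCompact_Icc Ioo_subset_Icc_self
    exact (continuousOn_kernel μ y).mono fun t ht => lt_of_le_of_lt ht.2 (hm'm.trans_le hmy)
  -- away from the base point: `v` continuous on a compact set, kernel integrable
  have h2 : IntegrableOn (fun t => v t * ((y - t : ℝ) : ℂ) ^ (μ - 1)) (Icc m' m) := by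
    refine IntegrableOn.continuousOn_mul_of_subset ?_ ?_ isCompact_Icc measurableSet_Icc
      Subset.rfl
    · exact hv.1.mono fun t ht => ⟨ham'.trans_le ht.1, lt_of_le_of_lt ht.2 hmb⟩
    · have hi := (intervalIntegrable_iff_integrableOn_Icc_of_le (hm'm.le.trans hmy)).mp
        (intervalIntegrable_kernel hμ m' y)
      exact hi.mono_set (Icc_subset_Icc le_rfl hmy)
  refine (h1.union h2).mono_set fun t ht => ?_
  rcases lt_or_ge t m' with h | h
  · exact Or.inl ⟨ht.1, h⟩
  · exact Or.inr ⟨h, ht.2.le⟩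

/-- The convolution integrand `1_{(a,z)} v (t) · K_μ (y−t)` as an indicator. [folklore] -/
private theorem indicator_mul_rlKernel_eq {a z : ℝ} (v : ℝ → ℂ) (μ : ℂ) (y t : ℝ) :
    indicator (Ioo a z) v t * rlKernel μ (y - t) =
      indicator (Ioo a (min z y)) (fun t => v t * ((y - t : ℝ) : ℂ) ^ (μ - 1)) t := by
  by_cases ht : t ∈ Ioo a (min z y)
  · have htz : t ∈ Ioo a z := ⟨ht.1, lt_of_lt_of_le ht.2 (min_le_left _ _)⟩
    rw [indicator_of_mem ht, indicator_of_mem htz,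
      rlKernel_of_pos μ (sub_pos.mpr (lt_of_lt_of_le ht.2 (min_le_right _ _)))]
  · rw [indicator_of_notMem ht]
    rcases le_or_gt t a with hta | hta
    · rw [indicator_of_notMem (fun h : t ∈ Ioo a z => not_le.mpr h.1 hta), zero_mul]
    · have h' : min z y ≤ t := by
        by_contra h
        exact ht ⟨hta, not_le.mp h⟩
      rcases min_le_iff.mp h' with hzt | hyt
      · rw [indicator_of_notMem (fun h : t ∈ Ioo a z => not_le.mpr h.2 hzt), zero_mul]
      · rw [rlKernel_of_nonpos μ (sub_nonpos.mpr hyt), mul_zero]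

/-- Existence of the convolution `1_{(a,z)} v ⋆ K_μ` at every point (`a < z < b`, `Re μ > 0`).
[cite: SamkoKilbasMarichev1993, §2.3 (Lemma 2.1)] -/
theorem convolutionExistsAt_indicator_rlKernel {a b z : ℝ} {v : ℝ → ℂ} (hv : RLAdmissible a b v)
    {μ : ℂ} (hμ : 0 < μ.re) (hz : z ∈ Ioo a b) (y : ℝ) :
    ConvolutionExistsAt (indicator (Ioo a z) v) (rlKernel μ) y (ContinuousLinearMap.mul ℂ ℂ)
      volume := by
  unfold ConvolutionExistsAt
  simp only [ContinuousLinearMap.mul_apply']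
  have heq : (fun t => indicator (Ioo a z) v t * rlKernel μ (y - t)) =
      indicator (Ioo a (min z y)) (fun t => v t * ((y - t : ℝ) : ℂ) ^ (μ - 1)) :=
    funext (indicator_mul_rlKernel_eq v μ y)
  rw [heq, integrable_indicator_iff measurableSet_Ioo]
  rcases le_or_gt (min z y) a with hm | hm
  · rw [Ioo_eq_empty (fun h => not_le.mpr h hm)]
    exact integrableOn_empty
  · exact integrableOn_mul_kernel hv hμ hm (lt_of_le_of_lt (min_le_left _ _) hz.2)
      (min_le_right _ _)

/-- The power `t ↦ t^{μ−1}` is admissible on `(0, c)` for every `c` (`Re μ > 0`). [folklore] -/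
private theorem rlAdmissible_cpow {μ : ℂ} (hμ : 0 < μ.re) (c : ℝ) :
    RLAdmissible 0 c (fun t : ℝ => (t : ℂ) ^ (μ - 1)) := by
  refine ⟨(continuousOn_ofReal_cpow_Ioi _).mono fun t ht => ht.1, fun c' hc' => ?_⟩
  have h : -1 < (μ - 1).re := by simp; linarith
  have hi := intervalIntegral.intervalIntegrable_cpow' (a := 0) (b := c') h
  rw [intervalIntegrable_iff_integrableOn_Ioo_of_le hc'.1.le] at hi
  exact hi

/-- On `t < c`, the kernel `K_μ (t)` agrees with `1_{(0,c)} (·)^{μ−1}`. [folklore] -/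
private theorem rlKernel_eq_indicator_of_lt (μ : ℂ) {c t : ℝ} (ht : t < c) :
    rlKernel μ t = indicator (Ioo 0 c) (fun s : ℝ => (s : ℂ) ^ (μ - 1)) t := by
  by_cases h : 0 < t
  · rw [rlKernel_of_pos μ h, indicator_of_mem (show t ∈ Ioo 0 c from ⟨h, ht⟩)]
  · have h0 : t ≤ 0 := not_lt.mp h
    rw [rlKernel_of_nonpos μ h0,
      indicator_of_notMem (fun h' : t ∈ Ioo 0 c => not_lt.mpr h0 h'.1)]

/-- The kernel–kernel convolution integrand `K_μ(t) K_ν(x−t)` is integrable (`Re μ, Re ν > 0`):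
a scaled Beta integrand. [cite: SamkoKilbasMarichev1993, §2.3 (2.21)] -/
theorem integrable_rlKernel_mul_rlKernel {μ ν : ℂ} (hμ : 0 < μ.re) (hν : 0 < ν.re) (x : ℝ) :
    Integrable (fun t => rlKernel μ t * rlKernel ν (x - t)) volume := by
  -- replace `K_μ` by `1_{(0, x+1)} (·)^{μ−1}`: the two integrands agree everywhere
  have hx1 : x + 1 ∈ Ioo 0 (x + 2) ∨ x + 1 ≤ 0 := by
    rcases le_or_gt (x + 1) 0 with h | h
    · exact Or.inr h
    · exact Or.inl ⟨h, by linarith⟩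
  have heq : (fun t => rlKernel μ t * rlKernel ν (x - t)) =
      fun t => indicator (Ioo 0 (x + 1)) (fun s : ℝ => (s : ℂ) ^ (μ - 1)) t * rlKernel ν (x - t) := by
    funext t
    rcases lt_or_ge t (x + 1) with ht | ht
    · rw [rlKernel_eq_indicator_of_lt μ ht]
    · rw [rlKernel_of_nonpos ν (by linarith : x - t ≤ 0), mul_zero, mul_zero]
  rw [heq]
  rcases hx1 with h | h
  · exact convolutionExistsAt_indicator_rlKernel (rlAdmissible_cpow hμ (x + 2)) hν h x
  · -- `x + 1 ≤ 0`: the integrand vanishes identically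
    have : (fun t => indicator (Ioo 0 (x + 1)) (fun s : ℝ => (s : ℂ) ^ (μ - 1)) t *
        rlKernel ν (x - t)) = fun _ => 0 := by
      funext t
      rw [Ioo_eq_empty (fun h' => not_le.mpr h' h), indicator_empty, zero_mul]
    rw [this]
    exact integrable_zero ℝ ℂ volume

/-- Norms of the kernel–kernel integrand, integrable. [cite: SamkoKilbasMarichev1993, §2.3 (2.21)] -/
theorem convolutionExistsAt_norm_rlKernel {μ ν : ℂ} (hμ : 0 < μ.re) (hν : 0 < ν.re) (x : ℝ) :
    ConvolutionExistsAt (fun t => ‖rlKernel μ t‖) (fun t => ‖rlKernel ν t‖) x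
      (ContinuousLinearMap.mul ℝ ℝ) volume := by
  unfold ConvolutionExistsAt
  simp only [ContinuousLinearMap.mul_apply', ← norm_mul]
  exact (integrable_rlKernel_mul_rlKernel hμ hν x).norm

/-- The norm of the kernel is the kernel of the real part of the order:
`‖K_μ (t)‖ = Re (K_{Re μ} (t))`. [folklore] -/
private theorem norm_rlKernel_eq_re (μ : ℂ) (t : ℝ) :
    ‖rlKernel μ t‖ = (rlKernel (μ.re : ℂ) t).re := by
  rcases le_or_gt t 0 with ht | ht
  · rw [rlKernel_of_nonpos _ ht, rlKernel_of_nonpos _ ht]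
    simp
  · rw [norm_rlKernel_of_pos μ ht, rlKernel_of_pos _ ht,
      show ((μ.re : ℂ) - 1) = ((μ.re - 1 : ℝ) : ℂ) by push_cast; ring, ← ofReal_cpow ht.le,
      ofReal_re]

/-- The kernel of a real order is real-valued: `Im K_r (t) = 0`. [folklore] -/
private theorem rlKernel_ofReal_im (r t : ℝ) : (rlKernel (r : ℂ) t).im = 0 := by
  rcases le_or_gt t 0 with ht | ht
  · rw [rlKernel_of_nonpos _ ht]
    simp
  · rw [rlKernel_of_pos _ ht, show ((r : ℂ) - 1) = ((r - 1 : ℝ) : ℂ) by push_cast; ring,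
      ← ofReal_cpow ht.le, ofReal_im]

/-- The convolution of the NORMS of two kernels is `Re B(Re μ, Re ν)` times the norm of the
kernel of order `Re μ + Re ν`. [cite: SamkoKilbasMarichev1993, §2.3 (2.21)] -/
theorem convolution_norm_rlKernel {μ ν : ℂ} (hμ : 0 < μ.re) (hν : 0 < ν.re) (y : ℝ) :
    ((fun t => ‖rlKernel μ t‖) ⋆[ContinuousLinearMap.mul ℝ ℝ, volume] fun t => ‖rlKernel ν t‖) y
      = (betaIntegral (μ.re : ℂ) (ν.re : ℂ)).re * ‖rlKernel ((μ.re + ν.re : ℝ) : ℂ) y‖ := by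
  rw [convolution_def]
  simp only [ContinuousLinearMap.mul_apply']
  have hμ' : 0 < ((μ.re : ℂ)).re := by simpa using hμ
  have hν' : 0 < ((ν.re : ℂ)).re := by simpa using hν
  have hint := integrable_rlKernel_mul_rlKernel hμ' hν' y
  have hpt : ∀ t : ℝ, ‖rlKernel μ t‖ * ‖rlKernel ν (y - t)‖ =
      (rlKernel (μ.re : ℂ) t * rlKernel (ν.re : ℂ) (y - t)).re := by
    intro t
    rw [norm_rlKernel_eq_re, norm_rlKernel_eq_re, Complex.mul_re, rlKernel_ofReal_im,
      rlKernel_ofReal_im, mul_zero, sub_zero]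
  simp_rw [hpt]
  have hre := integral_re hint
  simp only [RCLike.re_to_complex] at hre
  have hconv := convolution_rlKernel (μ.re : ℂ) (ν.re : ℂ) y
  rw [convolution_def] at hconv
  simp only [ContinuousLinearMap.mul_apply'] at hconv
  rw [hre, hconv, Complex.mul_re, norm_rlKernel_eq_re]
  have : ((μ.re : ℂ) + (ν.re : ℂ)) = (((μ.re + ν.re : ℝ) : ℂ)) := by push_cast; ring
  rw [this, rlKernel_ofReal_im, mul_zero, sub_zero]
  simp

/-! ### The semigroup law -/

/-- **Semigroup law of Riemann–Liouville integration** (Gamma-free form): for `v` continuous on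
`(a,b)` and integrable near `a`, `Re μ > 0`, `Re ν > 0` and `z ∈ (a,b)`,
`J^ν_{a+} (J^μ_{a+} v)(z) = B(μ,ν) · J^{μ+ν}_{a+} v (z)`. Proof: associativity of convolution on
`ℝ` applied to `1_{(a,z)} v`, `K_μ`, `K_ν`, and `K_μ ⋆ K_ν = B(μ,ν) K_{μ+ν}`.
[cite: SamkoKilbasMarichev1993, §2.3 (2.21)] -/
theorem rlIntegral_rlIntegral {a b : ℝ} {v : ℝ → ℂ} (hv : RLAdmissible a b v) {μ ν : ℂ}
    (hμ : 0 < μ.re) (hν : 0 < ν.re) {z : ℝ} (hz : z ∈ Ioo a b) :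
    rlIntegral a ν (rlIntegral a μ v) z = betaIntegral μ ν * rlIntegral a (μ + ν) v z := by
  set V : ℝ → ℂ := indicator (Ioo a z) v with hV
  set L := ContinuousLinearMap.mul ℂ ℂ with hL
  -- left-hand side as an iterated convolution
  have h1 : ((V ⋆[L, volume] rlKernel μ) ⋆[L, volume] rlKernel ν) z =
      rlIntegral a ν (rlIntegral a μ v) z := by
    rw [← convolution_indicator_rlKernel (rlIntegral a μ v) ν hz.1 le_rfl, convolution_def,
      convolution_def]
    refine integral_congr_ae (Eventually.of_forall fun t => ?_)
    simp only [hL, ContinuousLinearMap.mul_apply']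
    rcases le_or_gt z t with hzt | hzt
    · rw [rlKernel_of_nonpos ν (sub_nonpos.mpr hzt), mul_zero, mul_zero]
    · rcases le_or_gt t a with hta | hta
      · rw [hV, convolution_indicator_rlKernel_of_le v μ hta,
          indicator_of_notMem (fun h : t ∈ Ioo a z => not_le.mpr h.1 hta)]
      · rw [hV, convolution_indicator_rlKernel v μ hta hzt.le,
          indicator_of_mem (show t ∈ Ioo a z from ⟨hta, hzt⟩)]
  -- right-hand side
  have h2 : (V ⋆[L, volume] (rlKernel μ ⋆[L, volume] rlKernel ν)) z =
      betaIntegral μ ν * rlIntegral a (μ + ν) v z := by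
    have hk : (rlKernel μ ⋆[L, volume] rlKernel ν) = betaIntegral μ ν • rlKernel (μ + ν) := by
      funext y
      rw [hL, convolution_rlKernel μ ν y, Pi.smul_apply, smul_eq_mul]
    rw [hk, convolution_smul, Pi.smul_apply, smul_eq_mul, hV, hL,
      convolution_indicator_rlKernel v (μ + ν) hz.1 le_rfl]
  -- associativity
  have hassoc : ((V ⋆[L, volume] rlKernel μ) ⋆[L, volume] rlKernel ν) z =
      (V ⋆[L, volume] (rlKernel μ ⋆[L, volume] rlKernel ν)) z := by
    refine convolution_assoc L L L L (fun x y w => by simp [hL, mul_assoc]) ?_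
      (aestronglyMeasurable_rlKernel μ) (aestronglyMeasurable_rlKernel ν)
      (Eventually.of_forall fun y => ?_) (Eventually.of_forall fun x => ?_) ?_
    · rw [hV, aestronglyMeasurable_indicator_iff measurableSet_Ioo]
      exact (hv.1.mono (Ioo_subset_Ioo_right hz.2.le)).aestronglyMeasurable measurableSet_Ioo
    · exact convolutionExistsAt_indicator_rlKernel hv hμ hz y
    · exact convolutionExistsAt_norm_rlKernel hμ hν x
    · -- `‖V‖ ⋆ (‖K_μ‖ ⋆ ‖K_ν‖)` exists at `z`
      unfold ConvolutionExistsAt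
      have hG : ((fun t => ‖rlKernel μ t‖) ⋆[ContinuousLinearMap.mul ℝ ℝ, volume]
          fun t => ‖rlKernel ν t‖) = fun y =>
          (betaIntegral (μ.re : ℂ) (ν.re : ℂ)).re * ‖rlKernel ((μ.re + ν.re : ℝ) : ℂ) y‖ :=
        funext (convolution_norm_rlKernel hμ hν)
      rw [hG]
      simp only [ContinuousLinearMap.mul_apply']
      have hr : 0 < (((μ.re + ν.re : ℝ) : ℂ)).re := by simp; linarith
      have hi := (convolutionExistsAt_indicator_rlKernel hv hr hz z).norm.const_mul
        (betaIntegral (μ.re : ℂ) (ν.re : ℂ)).re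
      refine hi.congr (Eventually.of_forall fun t => ?_)
      simp only [ContinuousLinearMap.mul_apply', norm_mul, hV]
      rw [norm_indicator_eq_indicator_norm]
      ring
  rw [← h1, hassoc, h2]

/-! ### Admissibility of branch data -/

/-- An admissible function is interval integrable from the base point. [folklore] -/
private theorem RLAdmissible.intervalIntegrable {a b : ℝ} {v : ℝ → ℂ} (hv : RLAdmissible a b v) {c : ℝ}
    (hc : c ∈ Ioo a b) : IntervalIntegrable v volume a c := by
  rw [intervalIntegrable_iff_integrableOn_Ioo_of_le hc.1.le]
  exact hv.2 c hc

/-- **Branch data are admissible.** If `v` is continuous on `(a,b)` and `v = (w−a)^ρ h(w)` on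
`(a, a+e)` with `Re ρ > −1` and `h` continuous on `(a−e, a+e)`, then `v` is admissible.
[cite: SamkoKilbasMarichev1993, §2.3 (Lemma 2.2)] -/
theorem rlAdmissible_of_branch {a b : ℝ} {v : ℝ → ℂ} (hv : ContinuousOn v (Ioo a b)) {ρ : ℂ}
    (hρ : -1 < ρ.re) {e : ℝ} (he : 0 < e) {h : ℝ → ℂ} (hh : ContinuousOn h (Ioo (a - e) (a + e)))
    (hvh : ∀ w ∈ Ioo a (a + e), v w = ((w - a : ℝ) : ℂ) ^ ρ * h w) : RLAdmissible a b v := by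
  refine ⟨hv, fun c hc => ?_⟩
  set m := a + min (e / 2) ((c - a) / 2) with hm
  have hmpos : 0 < min (e / 2) ((c - a) / 2) := lt_min (by linarith) (by linarith [hc.1])
  have ham : a < m := by rw [hm]; linarith
  have hmc : m < c := by
    have : min (e / 2) ((c - a) / 2) ≤ (c - a) / 2 := min_le_right _ _
    rw [hm]; linarith [hc.1]
  have hme : m < a + e := by
    have : min (e / 2) ((c - a) / 2) ≤ e / 2 := min_le_left _ _
    rw [hm]; linarith
  -- near `a`: the power is integrable, `h` is continuous on `[a, m]`
  have h1 : IntegrableOn v (Ioo a m) := by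
    have hp : IntegrableOn (fun w : ℝ => ((w - a : ℝ) : ℂ) ^ ρ) (Ioo a m) := by
      have hi := (intervalIntegral.intervalIntegrable_cpow' (a := 0) (b := m - a) hρ).comp_sub_right a
      simp only [zero_add, sub_add_cancel] at hi
      exact (intervalIntegrable_iff_integrableOn_Ioo_of_le ham.le).mp hi
    have hprod : IntegrableOn (fun w : ℝ => ((w - a : ℝ) : ℂ) ^ ρ * h w) (Ioo a m) :=
      hp.mul_continuousOn_of_subset (hh.mono fun w hw => ⟨by linarith [hw.1], lt_of_le_of_lt hw.2 hme⟩)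
        measurableSet_Ioo isCompact_Icc Ioo_subset_Icc_self
    exact hprod.congr_fun (fun w hw => (hvh w ⟨hw.1, hw.2.trans hme⟩).symm) measurableSet_Ioo
  -- away from `a`: `v` is continuous on the compact `[m, c]`
  have h2 : IntegrableOn v (Icc m c) :=
    (hv.mono fun w hw => ⟨ham.trans_le hw.1, lt_of_le_of_lt hw.2 hc.2⟩).integrableOn_compact
      isCompact_Icc
  refine (h1.union h2).mono_set fun t ht => ?_
  rcases lt_or_ge t m with h | h
  · exact Or.inl ⟨ht.1, h⟩
  · exact Or.inr ⟨h, ht.2.le⟩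

/-! ### Integer orders: `J^1` is a primitive, `(J^{n+2})' = (n+1) J^{n+1}` -/

/-- `J^1_{a+} v (z) = ∫_a^z v`. [cite: SamkoKilbasMarichev1993, §2.3] -/
theorem rlIntegral_one (a : ℝ) (v : ℝ → ℂ) (z : ℝ) : rlIntegral a 1 v z = ∫ w in a..z, v w := by
  unfold rlIntegral
  simp

/-- `J^1_{a+} v` is a primitive of `v` on `(a,b)`. [cite: SamkoKilbasMarichev1993, §2.5] -/
theorem hasDerivAt_rlIntegral_one {a b : ℝ} {v : ℝ → ℂ} (hv : RLAdmissible a b v) {z : ℝ}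
    (hz : z ∈ Ioo a b) : HasDerivAt (rlIntegral a 1 v) (v z) z := by
  have h : rlIntegral a 1 v = fun x => ∫ w in a..x, v w := funext (rlIntegral_one a v)
  rw [h]
  exact intervalIntegral.integral_hasDerivAt_right (hv.intervalIntegrable hz)
    (hv.1.stronglyMeasurableAtFilter isOpen_Ioo z hz) (hv.1.continuousAt (Ioo_mem_nhds hz.1 hz.2))

/-- A priori bound for integer orders: `‖J^{n+1} v (x)‖ ≤ (c−a)^n ∫_a^c ‖v‖` for
`a < x ≤ c < b`. [cite: SamkoKilbasMarichev1993, §2.3] -/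
theorem norm_rlIntegral_natCast_succ_le {a b : ℝ} {v : ℝ → ℂ} (hv : RLAdmissible a b v)
    (n : ℕ) {x c : ℝ} (hax : a < x) (hxc : x ≤ c) (hcb : c < b) :
    ‖rlIntegral a ((n : ℂ) + 1) v x‖ ≤ (c - a) ^ n * ∫ w in a..c, ‖v w‖ := by
  unfold rlIntegral
  have hvi : IntervalIntegrable (fun w => ‖v w‖) volume a c :=
    (hv.intervalIntegrable ⟨hax.trans_le hxc, hcb⟩).norm
  have hvi' : IntervalIntegrable (fun w => (c - a) ^ n * ‖v w‖) volume a x :=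
    (hvi.mono_set (by
      rw [uIcc_of_le hax.le, uIcc_of_le (hax.le.trans hxc)]
      exact Icc_subset_Icc le_rfl hxc)).const_mul _
  calc ‖∫ w in a..x, ((x - w : ℝ) : ℂ) ^ ((n : ℂ) + 1 - 1) * v w‖
      ≤ ∫ w in a..x, (c - a) ^ n * ‖v w‖ := by
        refine intervalIntegral.norm_integral_le_of_norm_le hax.le
          (Eventually.of_forall fun w hw => ?_) hvi'
        rw [add_sub_cancel_right, cpow_natCast, norm_mul, norm_pow, Complex.norm_real,
          Real.norm_eq_abs, abs_of_nonneg (by linarith [hw.2] : (0 : ℝ) ≤ x - w)]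
        have h1 : (x - w) ^ n ≤ (c - a) ^ n :=
          pow_le_pow_left₀ (by linarith [hw.2]) (by linarith [hw.1]) n
        exact mul_le_mul_of_nonneg_right h1 (norm_nonneg _)
    _ = (c - a) ^ n * ∫ w in a..x, ‖v w‖ := intervalIntegral.integral_const_mul _ _
    _ ≤ (c - a) ^ n * ∫ w in a..c, ‖v w‖ := by
        refine mul_le_mul_of_nonneg_left ?_ (pow_nonneg (by linarith) n)
        refine intervalIntegral.integral_mono_interval le_rfl hax.le hxc
          (Eventually.of_forall fun w => norm_nonneg _) hvi

/-- Integrability of `J^{n+1} v` near the base point (given its continuity on `(a,b)`, which is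
established inductively below). [cite: SamkoKilbasMarichev1993, §2.3] -/
theorem integrableOn_rlIntegral_natCast_succ {a b : ℝ} {v : ℝ → ℂ} (hv : RLAdmissible a b v)
    (n : ℕ) (hcont : ContinuousOn (rlIntegral a ((n : ℂ) + 1) v) (Ioo a b)) {c : ℝ}
    (hc : c ∈ Ioo a b) : IntegrableOn (rlIntegral a ((n : ℂ) + 1) v) (Ioo a c) := by
  have hmeas : AEStronglyMeasurable (rlIntegral a ((n : ℂ) + 1) v) (volume.restrict (Ioo a c)) :=
    (hcont.mono (Ioo_subset_Ioo_right hc.2.le)).aestronglyMeasurable measurableSet_Ioo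
  have hC : IntegrableOn (fun _ : ℝ => (c - a) ^ n * ∫ w in a..c, ‖v w‖) (Ioo a c) :=
    integrableOn_const (hs := measure_Ioo_lt_top.ne)
  refine Integrable.mono' hC hmeas ?_
  refine (ae_restrict_iff' measurableSet_Ioo).mpr (Eventually.of_forall fun x hx => ?_)
  exact norm_rlIntegral_natCast_succ_le hv n hx.1 hx.2.le hc.2

/-- The recursion `J^{n+2} v (z) = (n+1) ∫_a^z J^{n+1} v` (semigroup law with `ν = 1`,
`B(n+1,1) = 1/(n+1)`). [cite: SamkoKilbasMarichev1993, §2.3 (2.21)] -/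
theorem rlIntegral_natCast_add_two {a b : ℝ} {v : ℝ → ℂ} (hv : RLAdmissible a b v) (n : ℕ)
    {z : ℝ} (hz : z ∈ Ioo a b) :
    rlIntegral a ((n : ℂ) + 2) v z = ((n : ℂ) + 1) * ∫ x in a..z, rlIntegral a ((n : ℂ) + 1) v x := by
  have hn : 0 < ((n : ℂ) + 1).re := by
    simp only [add_re, natCast_re, one_re]; positivity
  have h := rlIntegral_rlIntegral hv (μ := (n : ℂ) + 1) (ν := 1) hn (by simp) hz
  rw [rlIntegral_one, betaIntegral_eval_one_right hn] at h
  have hn' : ((n : ℂ) + 1) ≠ 0 := by exact_mod_cast Nat.succ_ne_zero n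
  rw [show (n : ℂ) + 2 = (n : ℂ) + 1 + 1 by ring, h]
  field_simp

/-- The successive derivatives of `J^{n+1} v`: `rlDerivSeq a v 0 = v`,
`rlDerivSeq a v (n+1) = (n+1) · J^{n+1} v`. [cite: SamkoKilbasMarichev1993, §2.5] -/
def rlDerivSeq (a : ℝ) (v : ℝ → ℂ) : ℕ → ℝ → ℂ
  | 0 => v
  | n + 1 => fun z => ((n : ℂ) + 1) * rlIntegral a ((n : ℂ) + 1) v z

/-- **Derivative of the integer-order Riemann–Liouville integrals**: on `(a,b)`,
`(J^1 v)' = v` and `(J^{n+2} v)' = (n+1) J^{n+1} v`. [cite: SamkoKilbasMarichev1993, §2.5] -/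
theorem hasDerivAt_rlIntegral_natCast_succ {a b : ℝ} {v : ℝ → ℂ} (hv : RLAdmissible a b v)
    (n : ℕ) {z : ℝ} (hz : z ∈ Ioo a b) :
    HasDerivAt (rlIntegral a ((n : ℂ) + 1) v) (rlDerivSeq a v n z) z := by
  induction n generalizing z with
  | zero =>
    have := hasDerivAt_rlIntegral_one hv hz
    simpa [rlDerivSeq] using this
  | succ n ih =>
    have hcont : ContinuousOn (rlIntegral a ((n : ℂ) + 1) v) (Ioo a b) := fun x hx =>
      (ih hx).continuousAt.continuousWithinAt
    set g := rlIntegral a ((n : ℂ) + 1) v with hg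
    have hgi : IntervalIntegrable g volume a z := by
      rw [intervalIntegrable_iff_integrableOn_Ioo_of_le hz.1.le]
      exact integrableOn_rlIntegral_natCast_succ hv n hcont hz
    have hG : HasDerivAt (fun x => ∫ t in a..x, g t) (g z) z :=
      intervalIntegral.integral_hasDerivAt_right hgi
        (hcont.stronglyMeasurableAtFilter isOpen_Ioo z hz)
        (hcont.continuousAt (Ioo_mem_nhds hz.1 hz.2))
    have hG' := hG.const_mul ((n : ℂ) + 1)
    have heq : rlIntegral a (((n + 1 : ℕ) : ℂ) + 1) v =ᶠ[𝓝 z]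
        fun x => ((n : ℂ) + 1) * ∫ t in a..x, g t := by
      filter_upwards [Ioo_mem_nhds hz.1 hz.2] with x hx
      rw [show (((n + 1 : ℕ) : ℂ) + 1) = (n : ℂ) + 2 by push_cast; ring,
        rlIntegral_natCast_add_two hv n hx]
    have := hG'.congr_of_eventuallyEq heq
    simpa [rlDerivSeq] using this

/-- `J^{n+1} v` is continuous on `(a,b)`. [cite: SamkoKilbasMarichev1993, §2.3] -/
theorem continuousOn_rlIntegral_natCast_succ {a b : ℝ} {v : ℝ → ℂ} (hv : RLAdmissible a b v)
    (n : ℕ) : ContinuousOn (rlIntegral a ((n : ℂ) + 1) v) (Ioo a b) := fun _ hx =>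
  (hasDerivAt_rlIntegral_natCast_succ hv n hx).continuousAt.continuousWithinAt

/-! ### `J^ν` of the powers `(w−a)^j` -/

/-- `J^ν_{a+} [(w−a)^j] (z) = B(j+1, ν) (z−a)^{j+ν}` for `z > a`.
[cite: SamkoKilbasMarichev1993, §2.5 (2.44)] -/
theorem rlIntegral_pow (a : ℝ) (ν : ℂ) (j : ℕ) {z : ℝ} (hz : a < z) :
    rlIntegral a ν (fun w => ((w - a : ℝ) : ℂ) ^ j) z =
      betaIntegral ((j : ℂ) + 1) ν * ((z - a : ℝ) : ℂ) ^ ((j : ℂ) + ν) := by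
  unfold rlIntegral
  have hs := betaIntegral_scaled ((j : ℂ) + 1) ν (sub_pos.mpr hz)
  rw [add_sub_cancel_right, show (j : ℂ) + 1 + ν - 1 = (j : ℂ) + ν by ring] at hs
  have heq : (fun w : ℝ => ((z - w : ℝ) : ℂ) ^ (ν - 1) * ((w - a : ℝ) : ℂ) ^ j) =
      fun w => (fun x : ℝ => (x : ℂ) ^ (j : ℂ) * (((z - a : ℝ) : ℂ) - x) ^ (ν - 1)) (w - a) := by
    funext w
    simp only [cpow_natCast]
    push_cast
    ring_nf
  rw [heq, intervalIntegral.integral_comp_sub_right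
    (fun x : ℝ => (x : ℂ) ^ (j : ℂ) * (((z - a : ℝ) : ℂ) - x) ^ (ν - 1)) a, sub_self]
  push_cast at hs ⊢
  rw [hs, mul_comm]

/-! ### A vanishing derivative tower forces a polynomial -/

/-- The shifted monomial `z ↦ (z−a)^{j+1}/(j+1)` has derivative `(z−a)^j`. [folklore] -/
private theorem hasDerivAt_pow_sub_div (a : ℝ) (j : ℕ) (z : ℝ) :
    HasDerivAt (fun x : ℝ => ((x - a : ℝ) : ℂ) ^ (j + 1) / ((j : ℂ) + 1)) (((z - a : ℝ) : ℂ) ^ j) z := by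
  have h1 : HasDerivAt (fun x : ℝ => ((x - a : ℝ) : ℂ)) 1 z := by
    have := ((hasDerivAt_id z).sub_const a).ofReal_comp
    simpa using this
  have h2 : HasDerivAt (fun x : ℝ => ((x - a : ℝ) : ℂ) ^ (j + 1))
      (((j : ℂ) + 1) * ((z - a : ℝ) : ℂ) ^ j) z := by
    refine (h1.pow (j + 1)).congr_deriv ?_
    simp
  have hj : ((j : ℂ) + 1) ≠ 0 := by exact_mod_cast Nat.succ_ne_zero j
  refine (h2.div_const ((j : ℂ) + 1)).congr_deriv ?_
  field_simp

/-- **A function whose `k`-th derivative vanishes on an interval is a polynomial of degree `< k`.**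
If `F 0, F 1, …, F k` is a tower of derivatives on `(a,b)` (`(F i)' = F (i+1)`) and `F k ≡ 0`,
then `F 0 (z) = Σ_{j<k} c_j (z−a)^j` on `(a,b)` (the mean value theorem, iterated).
[cite: Rudin1976, Theorem 5.11(b)] -/
theorem eq_polynomial_of_hasDerivAt_tower {a b : ℝ} (k : ℕ) (F : ℕ → ℝ → ℂ)
    (hF : ∀ i < k, ∀ z ∈ Ioo a b, HasDerivAt (F i) (F (i + 1) z) z)
    (hk : ∀ z ∈ Ioo a b, F k z = 0) :
    ∃ c : ℕ → ℂ, ∀ z ∈ Ioo a b, F 0 z = ∑ j ∈ Finset.range k, c j * ((z - a : ℝ) : ℂ) ^ j := by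
  induction k generalizing F with
  | zero => exact ⟨fun _ => 0, fun z hz => by simp [hk z hz]⟩
  | succ k ih =>
    obtain ⟨c, hc⟩ := ih (fun i => F (i + 1)) (fun i hi z hz => hF (i + 1) (by omega) z hz) hk
    -- `F 0 − P` has zero derivative, `P` an explicit primitive of the polynomial `F 1`
    set P : ℝ → ℂ := fun x => ∑ j ∈ Finset.range k, c j * (((x - a : ℝ) : ℂ) ^ (j + 1) / ((j : ℂ) + 1))
      with hP
    have hPd : ∀ z ∈ Ioo a b, HasDerivAt P (F 1 z) z := by
      intro z hz
      rw [hc z hz]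
      exact HasDerivAt.fun_sum fun j _ => (hasDerivAt_pow_sub_div a j z).const_mul (c j)
    have hD : ∀ z ∈ Ioo a b, HasDerivAt (F 0 - P) 0 z := by
      intro z hz
      have := (hF 0 (Nat.succ_pos k) z hz).sub (hPd z hz)
      simpa using this
    obtain ⟨c₀, hc₀⟩ := isOpen_Ioo.exists_is_const_of_deriv_eq_zero isPreconnected_Ioo
      (fun z hz => (hD z hz).differentiableAt.differentiableWithinAt)
      (fun z hz => (hD z hz).deriv)
    refine ⟨fun j => Nat.casesOn j c₀ fun i => c i / ((i : ℂ) + 1), fun z hz => ?_⟩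
    have h0 : F 0 z = c₀ + P z := by
      have := hc₀ z hz
      simp only [Pi.sub_apply] at this
      rw [← this]; ring
    rw [h0, Finset.sum_range_succ', hP]
    simp only [pow_zero, mul_one, pow_succ]
    rw [add_comm]
    congr 1
    refine Finset.sum_congr rfl fun j _ => ?_
    ring

/-! ### Powers with no natural exponent are independent of smooth functions -/

/-- Derivative of `x ↦ (x−a)^s` (complex power of the positive real `x − a`) at `x > a`:
`s (x−a)^{s−1}`. [folklore] -/
private theorem hasDerivAt_cpow_sub {a x : ℝ} (hx : a < x) (s : ℂ) :
    HasDerivAt (fun y : ℝ => ((y - a : ℝ) : ℂ) ^ s) (s * ((x - a : ℝ) : ℂ) ^ (s - 1)) x := by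
  have hxa : x - a ≠ 0 := (sub_pos.mpr hx).ne'
  rcases eq_or_ne s 0 with rfl | hs
  · simp only [cpow_zero, zero_mul]
    exact hasDerivAt_const x 1
  · have h2 : HasDerivAt (fun y : ℝ => y - a) 1 x := (hasDerivAt_id x).sub_const a
    have h1 : HasDerivAt (fun y : ℝ => (y : ℂ) ^ s) (s * ((x - a : ℝ) : ℂ) ^ (s - 1))
        ((fun y : ℝ => y - a) x) :=
      hasDerivAt_ofReal_cpow_const hxa hs
    have h3 := h1.scomp x h2
    rw [one_smul] at h3
    exact h3

/-- **A single power.** If `g` is smooth on `(a−e, a+e)` and `g(x) = c (x−a)^s` on `(a, a+e)`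
with `s ∉ ℕ`, then `c = 0`. (Induction on `⌊Re s⌋`: for `Re s < 0` the power is unbounded at
`a⁺`; otherwise differentiate.) [folklore] -/
private theorem eq_zero_of_cpow_eq_smooth {a e : ℝ} (he : 0 < e) {g : ℝ → ℂ}
    (hg : ContDiffOn ℝ ((⊤ : ℕ∞) : WithTop ℕ∞) g (Ioo (a - e) (a + e))) {s c : ℂ}
    (hs : ∀ m : ℕ, s ≠ m) (heq : ∀ x ∈ Ioo a (a + e), g x = c * ((x - a : ℝ) : ℂ) ^ s) : c = 0 := by
  suffices H : ∀ (n : ℕ) (s c : ℂ) (g : ℝ → ℂ), s.re < n → (∀ m : ℕ, s ≠ m) →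
      ContDiffOn ℝ ((⊤ : ℕ∞) : WithTop ℕ∞) g (Ioo (a - e) (a + e)) →
      (∀ x ∈ Ioo a (a + e), g x = c * ((x - a : ℝ) : ℂ) ^ s) → c = 0 by
    exact H (⌊s.re⌋₊ + 1) s c g (by exact_mod_cast Nat.lt_floor_add_one s.re) hs hg heq
  intro n
  induction n with
  | zero =>
    intro s c g hre _ hg heq
    by_contra hc
    have hcpos : 0 < ‖c‖ := norm_pos_iff.mpr hc
    -- `g` is bounded near `a`
    have hga : ContinuousAt g a :=
      hg.continuousOn.continuousAt (Ioo_mem_nhds (by linarith) (by linarith))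
    have hbd : ∀ᶠ x in 𝓝[>] a, ‖g x‖ ≤ ‖g a‖ + 1 := by
      have h1 : ∀ᶠ x in 𝓝 a, dist (g x) (g a) < 1 :=
        (Metric.tendsto_nhds.mp hga) 1 one_pos
      refine (h1.filter_mono nhdsWithin_le_nhds).mono fun x hx => ?_
      rw [dist_eq_norm] at hx
      have := norm_le_norm_add_norm_sub' (g x) (g a)
      linarith [norm_sub_rev (g x) (g a)]
    -- but `(x−a)^{Re s} → ∞`
    have hsub : Tendsto (fun x : ℝ => x - a) (𝓝[>] a) (𝓝[>] 0) := by
      refine tendsto_nhdsWithin_of_tendsto_nhds_of_eventually_within _ ?_ ?_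
      · have : Tendsto (fun x : ℝ => x - a) (𝓝 a) (𝓝 (a - a)) :=
          (continuous_id.sub continuous_const).tendsto a
        rw [sub_self] at this
        exact this.mono_left nhdsWithin_le_nhds
      · filter_upwards [self_mem_nhdsWithin] with x hx
        exact sub_pos.mpr (mem_Ioi.mp hx)
    have hlim : Tendsto (fun x : ℝ => (x - a) ^ s.re) (𝓝[>] a) atTop :=
      (tendsto_rpow_neg_nhdsGT_zero (by exact_mod_cast hre)).comp hsub
    have hbig : ∀ᶠ x in 𝓝[>] a, (‖g a‖ + 1) / ‖c‖ + 1 ≤ (x - a) ^ s.re :=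
      hlim.eventually (eventually_ge_atTop _)
    have hin : ∀ᶠ x in 𝓝[>] a, x ∈ Ioo a (a + e) :=
      Ioo_mem_nhdsGT (by linarith)
    obtain ⟨x, hx1, hx2, hx3⟩ := (hbd.and (hbig.and hin)).exists
    have hgx : ‖g x‖ = ‖c‖ * (x - a) ^ s.re := by
      rw [heq x hx3, norm_mul, norm_cpow_eq_rpow_re_of_pos (sub_pos.mpr hx3.1)]
    have h3 : ‖c‖ * ((‖g a‖ + 1) / ‖c‖ + 1) ≤ ‖c‖ * (x - a) ^ s.re :=
      mul_le_mul_of_nonneg_left hx2 hcpos.le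
    rw [mul_add, mul_div_cancel₀ _ hcpos.ne', mul_one] at h3
    linarith
  | succ n ih =>
    intro s c g hre hs hg heq
    -- differentiate once
    have hg' : ContDiffOn ℝ ((⊤ : ℕ∞) : WithTop ℕ∞) (deriv g) (Ioo (a - e) (a + e)) :=
      hg.deriv_of_isOpen isOpen_Ioo (by norm_cast)
    have heq' : ∀ x ∈ Ioo a (a + e), deriv g x = c * s * ((x - a : ℝ) : ℂ) ^ (s - 1) := by
      intro x hx
      have h1 : HasDerivAt (fun y : ℝ => c * ((y - a : ℝ) : ℂ) ^ s)
          (c * (s * ((x - a : ℝ) : ℂ) ^ (s - 1))) x :=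
        (hasDerivAt_cpow_sub hx.1 s).const_mul c
      have h2 : g =ᶠ[𝓝 x] fun y : ℝ => c * ((y - a : ℝ) : ℂ) ^ s := by
        filter_upwards [Ioo_mem_nhds hx.1 hx.2] with y hy
        exact heq y hy
      rw [(h1.congr_of_eventuallyEq h2).deriv, mul_assoc]
    have hs' : ∀ m : ℕ, s - 1 ≠ m := by
      intro m hm
      exact hs (m + 1) (by push_cast; exact sub_eq_iff_eq_add.mp hm)
    have hre' : (s - 1).re < n := by
      simp only [sub_re, one_re]
      push_cast at hre
      linarith
    have := ih (s - 1) (c * s) (deriv g) hre' hs' hg' heq'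
    rcases mul_eq_zero.mp this with h | h
    · exact h
    · exact absurd h (by exact_mod_cast hs 0)

/-- **Independence of powers from smooth functions.** If `g` is smooth on `(a−e, a+e)` and
`g(x) = Σ_{j<k} c_j (x−a)^{d+j}` on `(a, a+e)` where NO exponent `d + j` is a natural number,
then all `c_j = 0`. (Apply the Euler operator `(x−a) d/dx − (d+k−1)` to kill the top term and
induct; the last term is a single power.) [folklore] -/
private theorem cpow_sum_indep_of_smooth {a e : ℝ} (he : 0 < e) (k : ℕ) {g : ℝ → ℂ}
    (hg : ContDiffOn ℝ ((⊤ : ℕ∞) : WithTop ℕ∞) g (Ioo (a - e) (a + e))) {d : ℂ} {c : ℕ → ℂ}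
    (hd : ∀ j < k, ∀ m : ℕ, d + j ≠ m)
    (heq : ∀ x ∈ Ioo a (a + e), g x = ∑ j ∈ Finset.range k, c j * ((x - a : ℝ) : ℂ) ^ (d + j)) :
    ∀ j < k, c j = 0 := by
  induction k generalizing g c with
  | zero => intro j hj; exact absurd hj (Nat.not_lt_zero j)
  | succ k ih =>
    -- the Euler operator `E = (x−a) d/dx − (d+k)` applied to `g`
    set g₁ : ℝ → ℂ := fun x => ((x - a : ℝ) : ℂ) * deriv g x - (d + k) * g x with hg₁
    have hsm : ContDiffOn ℝ ((⊤ : ℕ∞) : WithTop ℕ∞) (fun x : ℝ => ((x - a : ℝ) : ℂ)) (Ioo (a - e) (a + e)) := by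
      have : ContDiff ℝ ((⊤ : ℕ∞) : WithTop ℕ∞) (fun x : ℝ => ((x - a : ℝ) : ℂ)) :=
        ofRealCLM.contDiff.comp (contDiff_id.sub contDiff_const)
      exact this.contDiffOn
    have hg₁s : ContDiffOn ℝ ((⊤ : ℕ∞) : WithTop ℕ∞) g₁ (Ioo (a - e) (a + e)) :=
      (hsm.mul (hg.deriv_of_isOpen isOpen_Ioo (by norm_cast))).sub (contDiffOn_const.mul hg)
    -- on `(a, a+e)`, `g₁ = Σ_{j<k} c_j (j−k) (x−a)^{d+j}` (the top term is killed)
    have hderiv : ∀ x ∈ Ioo a (a + e), deriv g x =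
        ∑ j ∈ Finset.range (k + 1), c j * ((d + j) * ((x - a : ℝ) : ℂ) ^ (d + j - 1)) := by
      intro x hx
      have h1 : HasDerivAt (fun y : ℝ => ∑ j ∈ Finset.range (k + 1), c j * ((y - a : ℝ) : ℂ) ^ (d + j))
          (∑ j ∈ Finset.range (k + 1), c j * ((d + j) * ((x - a : ℝ) : ℂ) ^ (d + j - 1))) x :=
        HasDerivAt.fun_sum fun j _ => (hasDerivAt_cpow_sub hx.1 (d + j)).const_mul (c j)
      have h2 : g =ᶠ[𝓝 x] fun y : ℝ => ∑ j ∈ Finset.range (k + 1), c j * ((y - a : ℝ) : ℂ) ^ (d + j) := by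
        filter_upwards [Ioo_mem_nhds hx.1 hx.2] with y hy
        exact heq y hy
      exact (h1.congr_of_eventuallyEq h2).deriv
    have heq₁ : ∀ x ∈ Ioo a (a + e),
        g₁ x = ∑ j ∈ Finset.range k, (c j * ((j : ℂ) - k)) * ((x - a : ℝ) : ℂ) ^ (d + j) := by
      intro x hx
      have hxa : ((x - a : ℝ) : ℂ) ≠ 0 := by exact_mod_cast (sub_pos.mpr hx.1).ne'
      have hpow : ∀ j : ℕ, ((x - a : ℝ) : ℂ) * ((x - a : ℝ) : ℂ) ^ (d + j - 1) =
          ((x - a : ℝ) : ℂ) ^ (d + j) := by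
        intro j
        rw [show d + j = (d + j - 1) + 1 by ring, cpow_add _ _ hxa, cpow_one]
        ring_nf
      simp only [hg₁]
      rw [hderiv x hx, heq x hx, Finset.mul_sum, Finset.mul_sum, ← Finset.sum_sub_distrib,
        Finset.sum_range_succ]
      have hlast : ((x - a : ℝ) : ℂ) * (c k * ((d + k) * ((x - a : ℝ) : ℂ) ^ (d + k - 1))) -
          (d + k) * (c k * ((x - a : ℝ) : ℂ) ^ (d + k)) = 0 := by
        rw [← hpow k]; ring
      rw [hlast, add_zero]
      refine Finset.sum_congr rfl fun j _ => ?_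
      rw [← hpow j]; ring
    have hc' := ih hg₁s (fun j hj m => hd j (Nat.lt_succ_of_lt hj) m) heq₁
    -- all lower coefficients vanish
    have hlow : ∀ j < k, c j = 0 := by
      intro j hj
      have h := hc' j hj
      rcases mul_eq_zero.mp h with h | h
      · exact h
      · exfalso
        have : (j : ℂ) = k := sub_eq_zero.mp h
        exact absurd (by exact_mod_cast this : j = k) (Nat.ne_of_lt hj)
    -- the top coefficient: a single power
    have htop : c k = 0 := by
      refine eq_zero_of_cpow_eq_smooth he hg (hd k (Nat.lt_succ_self k)) fun x hx => ?_
      rw [heq x hx, Finset.sum_range_succ, Finset.sum_eq_zero fun j hj => ?_, zero_add]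
      rw [hlow j (Finset.mem_range.mp hj), zero_mul]
    intro j hj
    rcases Nat.lt_succ_iff_lt_or_eq.mp hj with h | h
    · exact hlow j h
    · rw [h]; exact htop

/-! ### Linearity and congruence of `J^μ` -/

/-- `J^μ_{a+} f (z)` depends only on `f|_{(a,z]}`. [folklore] -/
private theorem rlIntegral_congr {a z : ℝ} (μ : ℂ) {f g : ℝ → ℂ} (haz : a ≤ z)
    (h : ∀ x ∈ Ioc a z, f x = g x) : rlIntegral a μ f z = rlIntegral a μ g z := by
  unfold rlIntegral
  refine intervalIntegral.integral_congr_ae (Eventually.of_forall fun x hx => ?_)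
  rw [uIoc_of_le haz] at hx
  rw [h x hx]

/-- `J^ν` of a polynomial in `(x−a)`, termwise. [cite: SamkoKilbasMarichev1993, §2.5 (2.44)] -/
theorem rlIntegral_polynomial (a : ℝ) {ν : ℂ} (hν : 0 < ν.re) (k : ℕ) (c : ℕ → ℂ) {z : ℝ}
    (hz : a < z) :
    rlIntegral a ν (fun x => ∑ j ∈ Finset.range k, c j * ((x - a : ℝ) : ℂ) ^ j) z =
      ∑ j ∈ Finset.range k, c j * (betaIntegral ((j : ℂ) + 1) ν * ((z - a : ℝ) : ℂ) ^ ((j : ℂ) + ν)) := by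
  have hterm : ∀ j : ℕ, IntervalIntegrable
      (fun x : ℝ => ((z - x : ℝ) : ℂ) ^ (ν - 1) * (c j * ((x - a : ℝ) : ℂ) ^ j)) volume a z := by
    intro j
    refine (intervalIntegrable_kernel hν a z).mul_continuousOn ?_
    exact (continuous_const.mul ((continuous_ofReal.comp (continuous_id.sub continuous_const)).pow j)).continuousOn
  unfold rlIntegral
  simp_rw [Finset.mul_sum]
  rw [intervalIntegral.integral_finsetSum fun j _ => hterm j]
  refine Finset.sum_congr rfl fun j _ => ?_
  have hp := rlIntegral_pow a ν j hz
  unfold rlIntegral at hp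
  rw [← hp, ← intervalIntegral.integral_const_mul]
  refine intervalIntegral.integral_congr fun x _ => ?_
  ring

/-- Euler's Beta integral does not vanish for positive real parts. [folklore] -/
private theorem betaIntegral_ne_zero {u w : ℂ} (hu : 0 < u.re) (hw : 0 < w.re) : betaIntegral u w ≠ 0 := by
  rw [betaIntegral_eq_Gamma_mul_div u w hu hw]
  refine div_ne_zero (mul_ne_zero (Gamma_ne_zero_of_re_pos hu) (Gamma_ne_zero_of_re_pos hw))
    (Gamma_ne_zero_of_re_pos ?_)
  simp only [add_re]; linarith

/-! ### The main theorem: injectivity off resonance -/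

/-- **Injectivity of the Riemann–Liouville integral on branch data, off resonance.** Let `v` be
continuous on `(a,b)` with `v = (w−a)^ρ h(w)` on `(a, a+e)`, `h` smooth on `(a−e, a+e)`,
`Re ρ > −1`; let `Re μ > 0`, `k ∈ ℕ` with the NON-RESONANCE condition `ρ + μ − k ∉ ℤ_{≤−1}`. If
`J^μ_{a+} v` agrees on `(a,b)` with a polynomial of degree `< k` in `(z−a)`, then `v ≡ 0` on
`(a,b)`. (With `u = ∂_z^k J^μ v` this is the injectivity of the Riemann–Liouville derivative
`D^{k−μ}_{a+}` on such data; at resonance it fails: `D^{k−μ}(w−a)^{k−μ−i} = 0`, `1 ≤ i ≤ k`.)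
Proof: `J^{N−μ} J^μ v = B · J^N v` (`N = ⌊Re μ⌋+1`) is explicit, `N` derivatives give
`v = Σ c'_j (w−a)^{j−μ}`, and `cpow_sum_indep_of_smooth` applies to `h = (w−a)^{−ρ} v` because
no `j − μ − ρ` is a natural number. [cite: SamkoKilbasMarichev1993, §2.5 (Thm 2.4, compositions) and §2.3 (2.21)] -/
theorem eq_zero_of_rlIntegral_eq_polynomial {a b : ℝ} {μ ρ : ℂ} (hμ : 0 < μ.re)
    (hρ : -1 < ρ.re) (k : ℕ) {v : ℝ → ℂ} (hv : ContinuousOn v (Ioo a b))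
    (hbr : ∃ e : ℝ, 0 < e ∧ ∃ h : ℝ → ℂ,
      ContDiffOn ℝ ((⊤ : ℕ∞) : WithTop ℕ∞) h (Ioo (a - e) (a + e)) ∧
      ∀ w ∈ Ioo a (a + e), v w = ((w - a : ℝ) : ℂ) ^ ρ * h w)
    (hres : ∀ n : ℕ, ρ + μ - k ≠ -((n : ℂ) + 1)) (c : ℕ → ℂ)
    (hpoly : ∀ z ∈ Ioo a b,
      rlIntegral a μ v z = ∑ j ∈ Finset.range k, c j * ((z - a : ℝ) : ℂ) ^ j) :
    ∀ w ∈ Ioo a b, v w = 0 := by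
  obtain ⟨e, he, h, hh, hvh⟩ := hbr
  have hadm : RLAdmissible a b v := rlAdmissible_of_branch hv hρ he hh.continuousOn hvh
  -- the complementary order `ν = n + 1 − μ`, `n = ⌊Re μ⌋`
  set n : ℕ := ⌊μ.re⌋₊ with hn
  set ν : ℂ := (n : ℂ) + 1 - μ with hν
  have hνre : 0 < ν.re := by
    have := Nat.lt_floor_add_one μ.re
    simp only [hν, sub_re, add_re, natCast_re, one_re]
    linarith
  have hB : betaIntegral μ ν ≠ 0 := betaIntegral_ne_zero hμ hνre
  -- STEP 1: `B(μ,ν) J^{n+1} v = Σ c_j B(j+1,ν) (z−a)^{j+ν}` on `(a,b)`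
  have hstep1 : ∀ z ∈ Ioo a b, betaIntegral μ ν * rlIntegral a ((n : ℂ) + 1) v z =
      ∑ j ∈ Finset.range k,
        c j * (betaIntegral ((j : ℂ) + 1) ν * ((z - a : ℝ) : ℂ) ^ ((j : ℂ) + ν)) := by
    intro z hz
    have hsg := rlIntegral_rlIntegral hadm hμ hνre hz
    rw [show μ + ν = (n : ℂ) + 1 by rw [hν]; ring] at hsg
    rw [← hsg, ← rlIntegral_polynomial a hνre k c hz.1]
    exact rlIntegral_congr ν hz.1.le fun x hx => hpoly x ⟨hx.1, lt_of_le_of_lt hx.2 hz.2⟩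
  -- STEP 2: differentiate `n + 1` times along the two towers
  let q : ℕ → ℕ → ℂ := fun i => Nat.rec (fun j => c j * betaIntegral ((j : ℂ) + 1) ν)
    (fun i qi j => qi j * ((j : ℂ) + ν - i)) i
  have hq0 : ∀ j, q 0 j = c j * betaIntegral ((j : ℂ) + 1) ν := fun j => rfl
  have hqs : ∀ i j, q (i + 1) j = q i j * ((j : ℂ) + ν - i) := fun i j => rfl
  let E : ℕ → ℝ → ℂ := fun i z =>
    ∑ j ∈ Finset.range k, q i j * ((z - a : ℝ) : ℂ) ^ ((j : ℂ) + ν - i)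
  have hE : ∀ i, ∀ z ∈ Ioo a b, HasDerivAt (E i) (E (i + 1) z) z := by
    intro i z hz
    have h1 : HasDerivAt (E i)
        (∑ j ∈ Finset.range k, q i j * (((j : ℂ) + ν - i) *
          ((z - a : ℝ) : ℂ) ^ ((j : ℂ) + ν - i - 1))) z :=
      HasDerivAt.fun_sum fun j _ => (hasDerivAt_cpow_sub hz.1 _).const_mul (q i j)
    refine h1.congr_deriv (Finset.sum_congr rfl fun j _ => ?_)
    rw [hqs, show ((j : ℂ) + ν - ((i + 1 : ℕ) : ℂ)) = (j : ℂ) + ν - i - 1 by push_cast; ring]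
    ring
  let κ : ℕ → ℂ := fun i => ∏ l ∈ Finset.range i, ((n : ℂ) - l)
  let G : ℕ → ℝ → ℂ := fun i z =>
    betaIntegral μ ν * κ i * rlIntegral a (((n - i : ℕ) : ℂ) + 1) v z
  have hS : ∀ i ≤ n, ∀ z ∈ Ioo a b, G i z = E i z := by
    intro i
    induction i with
    | zero =>
      intro _ z hz
      simp only [G, E, κ, Finset.prod_range_zero, mul_one, Nat.sub_zero, hq0, Nat.cast_zero,
        sub_zero]
      rw [hstep1 z hz]
      refine Finset.sum_congr rfl fun j _ => ?_
      ring
    | succ i ih =>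
      intro hi z hz
      have hi' : i ≤ n := Nat.le_of_succ_le hi
      -- `n - i = m + 1` with `m = n - (i+1)`
      set m := n - (i + 1) with hm
      have hnm : n - i = m + 1 := by omega
      -- derivative of `G i`
      have hGd : HasDerivAt (G i) (G (i + 1) z) z := by
        have hd := (hasDerivAt_rlIntegral_natCast_succ hadm (m + 1) hz).const_mul
          (betaIntegral μ ν * κ i)
        have hfun : G i = fun x => betaIntegral μ ν * κ i *
            rlIntegral a (((m + 1 : ℕ) : ℂ) + 1) v x := by
          funext x
          simp only [G, hnm]
        rw [hfun]
        refine hd.congr_deriv ?_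
        simp only [G, rlDerivSeq, κ, Finset.prod_range_succ]
        rw [← hm]
        have hcast : ((n : ℂ) - (i : ℂ)) = (m : ℂ) + 1 := by
          have : ((n - i : ℕ) : ℂ) = (n : ℂ) - (i : ℂ) := Nat.cast_sub hi'
          rw [← this, hnm]
          push_cast
          ring
        rw [hcast]
        ring
      -- uniqueness of the derivative along `Ioo a b`
      have heq : E i =ᶠ[𝓝 z] G i := by
        filter_upwards [Ioo_mem_nhds hz.1 hz.2] with x hx
        exact (ih hi' x hx).symm
      exact (hGd.congr_of_eventuallyEq heq).unique (hE i z hz)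
  -- the last derivative: `B κ_n v = E (n+1)` on `(a,b)`
  have hlast : ∀ z ∈ Ioo a b, betaIntegral μ ν * κ n * v z = E (n + 1) z := by
    intro z hz
    have hd := (hasDerivAt_rlIntegral_natCast_succ hadm 0 hz).const_mul (betaIntegral μ ν * κ n)
    have hfun : G n = fun x => betaIntegral μ ν * κ n * rlIntegral a (((0 : ℕ) : ℂ) + 1) v x := by
      funext x
      simp only [G, Nat.sub_self]
    have heq : E n =ᶠ[𝓝 z] G n := by
      filter_upwards [Ioo_mem_nhds hz.1 hz.2] with x hx
      exact (hS n le_rfl x hx).symm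
    rw [hfun] at heq
    have := (hd.congr_of_eventuallyEq heq).unique (hE n z hz)
    simpa [rlDerivSeq] using this
  have hκ : κ n ≠ 0 := by
    refine Finset.prod_ne_zero_iff.mpr fun l hl => sub_ne_zero.mpr ?_
    exact_mod_cast (Finset.mem_range.mp hl).ne'
  have hBκ : betaIntegral μ ν * κ n ≠ 0 := mul_ne_zero hB hκ
  -- the explicit formula `v = Σ c'_j (w−a)^{j−μ}` on `(a,b)`
  set c' : ℕ → ℂ := fun j => q (n + 1) j / (betaIntegral μ ν * κ n) with hc'
  have hformula : ∀ z ∈ Ioo a b,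
      v z = ∑ j ∈ Finset.range k, c' j * ((z - a : ℝ) : ℂ) ^ ((j : ℂ) - μ) := by
    intro z hz
    have h1 : v z = (betaIntegral μ ν * κ n)⁻¹ * E (n + 1) z := by
      rw [← hlast z hz]; field_simp
    rw [h1]
    simp only [E, Finset.mul_sum]
    refine Finset.sum_congr rfl fun j _ => ?_
    rw [show ((j : ℂ) + ν - ((n + 1 : ℕ) : ℂ)) = (j : ℂ) - μ by rw [hν]; push_cast; ring, hc']
    ring
  -- STEP 3: the branch at `a` forces all `c'_j = 0`
  intro w hw
  have hab : a < b := hw.1.trans hw.2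
  set e' := min e (b - a) with he'
  have he'pos : 0 < e' := lt_min he (sub_pos.mpr hab)
  have he'e : e' ≤ e := min_le_left _ _
  have he'b : e' ≤ b - a := min_le_right _ _
  have hh' : ContDiffOn ℝ ((⊤ : ℕ∞) : WithTop ℕ∞) h (Ioo (a - e') (a + e')) :=
    hh.mono (Ioo_subset_Ioo (by linarith) (by linarith))
  have hd : ∀ j < k, ∀ m : ℕ, -μ - ρ + j ≠ m := by
    intro j hj m hm
    obtain ⟨l, hl⟩ := Nat.exists_eq_add_of_lt hj
    refine hres (l + m) ?_
    rw [hl]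
    push_cast
    linear_combination -hm
  have hbranch : ∀ x ∈ Ioo a (a + e'),
      h x = ∑ j ∈ Finset.range k, c' j * ((x - a : ℝ) : ℂ) ^ (-μ - ρ + j) := by
    intro x hx
    have hxa : ((x - a : ℝ) : ℂ) ≠ 0 := by exact_mod_cast (sub_pos.mpr hx.1).ne'
    have hxb : x ∈ Ioo a b := ⟨hx.1, by linarith [hx.2]⟩
    have hxe : x ∈ Ioo a (a + e) := ⟨hx.1, by linarith [hx.2]⟩
    have hpow : ((x - a : ℝ) : ℂ) ^ ρ ≠ 0 := by
      rw [Ne, cpow_eq_zero_iff]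
      exact fun h0 => hxa h0.1
    have h1 : h x = ((x - a : ℝ) : ℂ) ^ (-ρ) * v x := by
      rw [hvh x hxe, cpow_neg, ← mul_assoc, inv_mul_cancel₀ hpow, one_mul]
    rw [h1, hformula x hxb, Finset.mul_sum]
    refine Finset.sum_congr rfl fun j _ => ?_
    rw [show (-μ - ρ + j : ℂ) = -ρ + ((j : ℂ) - μ) by ring, cpow_add _ _ hxa]
    ring
  have hzero := cpow_sum_indep_of_smooth he'pos k hh' hd hbranch
  rw [hformula w hw]
  exact Finset.sum_eq_zero fun j hj => by rw [hzero j (Finset.mem_range.mp hj), zero_mul]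

/-! ### The unit-interval form of `J^μ` (the shape of the one-sided Euler transform) -/

/-- **Substitution `w = a + (z−a)t`:** for `z > a`,
`J^μ_{a+} v (z) = (z−a)^μ ∫₀¹ (1−t)^{μ−1} v(a + (z−a)t) dt`. With `a = 1`, `μ = 1 − κ` this is
the one-sided Euler transform `Φ_κ[v](z) = (z−1)^{1−κ} ∫₀¹ (1−t)^{−κ} v(1+(z−1)t) dt` of
`HeunEulerTransform.lean` / `HeunEulerIntegrals.lean`. [cite: SamkoKilbasMarichev1993, §2.3 (2.17)–(2.18)] -/
theorem rlIntegral_eq_cpow_mul_integral (a : ℝ) (μ : ℂ) (v : ℝ → ℂ) {z : ℝ} (hz : a < z) :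
    rlIntegral a μ v z = ((z - a : ℝ) : ℂ) ^ μ *
      ∫ t in (0 : ℝ)..1, ((1 - t : ℝ) : ℂ) ^ (μ - 1) * v (a + (z - a) * t) := by
  have hza : 0 < z - a := sub_pos.mpr hz
  have hne : ((z - a : ℝ) : ℂ) ≠ 0 := by exact_mod_cast hza.ne'
  unfold rlIntegral
  have hsub := intervalIntegral.smul_integral_comp_mul_add
    (fun w : ℝ => ((z - w : ℝ) : ℂ) ^ (μ - 1) * v w) (z - a) a (a := 0) (b := 1)
  simp only [mul_zero, zero_add, mul_one, sub_add_cancel] at hsub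
  rw [← hsub]
  have hcongr : ∫ t in (0 : ℝ)..1, ((z - ((z - a) * t + a) : ℝ) : ℂ) ^ (μ - 1) * v ((z - a) * t + a) =
      ∫ t in (0 : ℝ)..1, ((z - a : ℝ) : ℂ) ^ (μ - 1) *
        (((1 - t : ℝ) : ℂ) ^ (μ - 1) * v (a + (z - a) * t)) := by
    refine intervalIntegral.integral_congr fun t ht => ?_
    rw [uIcc_of_le zero_le_one] at ht
    rw [show z - ((z - a) * t + a) = (z - a) * (1 - t) by ring,
      show (z - a) * t + a = a + (z - a) * t by ring, ofReal_mul,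
      mul_cpow_ofReal_nonneg hza.le (by linarith [ht.2]), mul_assoc]
  rw [hcongr, intervalIntegral.integral_const_mul, real_smul, ← mul_assoc]
  congr 1
  rw [show μ = (μ - 1) + 1 by ring, cpow_add _ _ hne, cpow_one, add_sub_cancel_right, mul_comm]

end RiemannLiouville

end Literature.Analysis.ODE
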